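/-
Copyright (c) 2026 the pub-hodgecm-mathlib formalisation cell (harness21).  Prover seat hodgecm-mathlib-K2Liu-p13 (g2), Track B «K2-LIT»,
#184♮ = hLiu418 = `stmt-HodgeConjecture-24832`; Road I v3 organ U1-CT-ind STAGE 2 (Q2), file F8: the E1 DICTIONARY of term 2 (E1 parameter `s − ½`).
-/
import Summits.HodgeConjecture.HodgeConjecture.Theorems.K2LiuKlingenInnerSectionBorelInvariant   -- ★ F5-p: `map_scaleY_one_eq` (+ ★ F5-n `klingenInner_hscale`, ★ F5-o, ★ F5-c the law)
import Summits.HodgeConjecture.HodgeConjecture.Theorems.K2LiuKlingenRestrictedSectionE1Law      -- ★ F7: `coe_jAdelic_two_symm` (+ ★ E1 `K2E1BorelEisensteinGodementU2`: `ofReal_sqrt_cpow_two_mul`, `summable_borelSection_two`)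
import HarnessLib

/-!
# Crux `HLiu418`, Road I v3, organ U1 stage 2 (Q2), file F8: THE INNER SECTION OF TERM 2 IN E1's CURRENCY —
# `F′_h(b g) = χ(u)·(√‖u‖)^{2(s−½)+1}·F′_h(g)` for ALL upper-triangular `b ∈ U(J₂)(𝔸)` (`u = b₀₀`): E1 parameter `s − ½`

Cell `hodgecm-mathlib`, crux item hLiu418 = `stmt-HodgeConjecture-24832`; squad K2 ∕ K2Liu; LEAD F0P6-plan (g14), co-dealer K2E5-plan (g7); prover K2Liu-p13 (g2).
THEOREMS ONLY (no `def`, no instance, no notation, no named-fact hypothesis, no `sorry`); lane `--supports stmt-HodgeConjecture-24832 --as helper` (count-neutral).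
`F(x) = ∫ f(Ψ(ξ)·Ψ(n_Q(y,0,t))·x) d(μ_Y × μ_T)` (the post-`u₊`-integration inner section; ★ F5-q: the orbit form is `C · F`), `F′_h(y) := F(Ψ(jAdelic₄ m_Q^𝔸(1, (jAdelic 2)⁻¹ y)) · h)`.
For adelic upper-triangular `b` with `b₀₀ = u`: ★ F5-c's law (at `a = 1`) × ★ F5-n's substitution modulus `δ = D_Y·D_T` with `D_Y = 1` (★ F5-p) and
`D_T = ‖u⁻¹‖_𝔸` (★ F5-o `map_mul_right_eq_ideleNorm_smul`) × the unfolding `siegelDeltaCharacter(Ψ(ξ m_Q(1,b) ξ⁻¹)) = χ(u)(√‖u‖)^{2s+2}`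
(★ F5-c `detDelta_transport_weylXi_conj_klingenLevi`: `det_Δ = b₀₀σ(1)⁻¹ = u`) give the factor `χ(u)(√‖u‖)^{2s+2}·‖u‖⁻¹ = χ(u)(√‖u‖)^{2(s−½)+1}`:
* `map_scaleT_eq_ideleNorm_smul`, `ideleNorm_inv_eq`, `sqrt_cpow_shift`;
* **`innerSection_borel_law`** — EXACTLY the `hF` of ★ E1 `summable_borelSection_two` at the parameter `s − ½`;
* **`summable_innerSection_of_continuous`** — Godement convergence of the E1 series of term 2 on `re s > 1` GIVEN the continuity of `F′_h` in `y` (a parametric integral; BY VALUE here).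
[MoeglinWaldspurger1995, II.1.5, II.1.7], [Tan1999, §1], [WeilBNT1967, Ch. IV §3], [Garrett2018, §3.10].
HONEST LABEL.  Count-neutral helper: `HC_CM` is proved only modulo the 7 printed citations (2 remaining named inputs: hLiu418 = `stmt-HodgeConjecture-24832`,
h413 = `stmt-HodgeConjecture-24833`) until rung 0 closes.
-/

set_option autoImplicit false
set_option linter.dupNamespace false -- the mandated namespace repeats `HodgeConjecture.HodgeConjecture`

noncomputable section

open scoped Matrix ENNReal NNReal
open NumberField IsDedekindDomain MeasureTheory MeasureTheory.Measure MulAction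

namespace Summit.HodgeConjecture.HodgeConjecture.Cruxes.HLiu418.K2LiuKlingenInnerSectionE1Law

open Literature.NumberTheory.Automorphic Literature.NumberTheory.Automorphic.UnitaryGroup
open Literature.NumberTheory.GelbartRogawski1991 Literature.NumberTheory.GelbartRogawski1991.GRConstruction
open Literature.NumberTheory.GaloisRepresentations
open Literature.NumberTheory.K2Lit.SiegelDoubled
open Summit.HodgeConjecture.HodgeConjecture.Cruxes.HLiu418.K2LiuDoubledUTwoTwoBorelFrame
open Summit.HodgeConjecture.HodgeConjecture.Cruxes.HLiu418.K2LiuKlingenParabolicDefs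
open Summit.HodgeConjecture.HodgeConjecture.Cruxes.HLiu418.K2LiuKlingenUnipotentDefs
open Summit.HodgeConjecture.HodgeConjecture.Cruxes.HLiu418.K2LiuKlingenUnipotentAdelicDefs
open Summit.HodgeConjecture.HodgeConjecture.Cruxes.HLiu418.K2LiuKlingenInnerSectionLeviLaw (klingenInner_levi_law detDelta_transport_weylXi_conj_klingenLevi)
open Summit.HodgeConjecture.HodgeConjecture.Cruxes.HLiu418.K2LiuKlingenInnerSectionModulus (klingenInner_hscale fst_klingenSubst snd_klingenSubst)
open Summit.HodgeConjecture.HodgeConjecture.Cruxes.HLiu418.K2LiuKlingenInnerSectionBorelInvariant (map_scaleY_one_eq)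
open Summit.HodgeConjecture.HodgeConjecture.Cruxes.HLiu418.K2LiuAdelicScalarModulus (map_mul_right_eq_ideleNorm_smul)
open Summit.HodgeConjecture.HodgeConjecture.Cruxes.HLiu418.K2LiuKlingenCellOneEisensteinU (klingenLevi_one_mul)
open Summit.HodgeConjecture.HodgeConjecture.Cruxes.HLiu418.K2LiuKlingenRestrictedSectionE1Law (coe_jAdelic_two_symm)
open Summit.HodgeConjecture.HodgeConjecture.Cruxes.HLiu418.K2LiuSiegelDoubledLeviMatrix (conjAdele_conjAdele')
open Summit.HodgeConjecture.HodgeConjecture.Cruxes.H413.K2E1BorelEisensteinGodementU2 (ofReal_sqrt_cpow_two_mul summable_borelSection_two)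
open UnitaryDualPair

variable {L : Type} [Field L] [NumberField L] [IsCMField L]
variable {N M : ℕ} {e : Fin N × Fin M ≃ Fin 2}
  {dV : Fin N → L} {hdV : ∀ i, IsCMField.complexConj L (dV i) = dV i}
  {dW : Fin M → L} {hdW : ∀ i, IsCMField.complexConj L (dW i) = dW i}

section Transport

variable {SA : GL (Fin (2 + 2)) (AdeleRing (𝓞 L) L)}
  {Ψ : (quasiSplit (Fp L) L (IsCMField.complexConj L) (2 + 2)).Adelic ≃ₜ* HA L e dV hdV dW hdW} {X Y : Matrix (Fin 2) (Fin 2) (Fp L)} {a : Fp L}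
  (hΨ : ∀ g : (quasiSplit (Fp L) L (IsCMField.complexConj L) (2 + 2)).Adelic,
    (((Ψ g : HA L e dV hdV dW hdW) : GL (Fin (2 + 2)) (AdeleRing (𝓞 L) L)) : Matrix (Fin (2 + 2)) (Fin (2 + 2)) (AdeleRing (𝓞 L) L)) =
      (SA : Matrix (Fin (2 + 2)) (Fin (2 + 2)) (AdeleRing (𝓞 L) L)) *
        ((adelicVal (Fp L) L (IsCMField.complexConj L) (2 + 2) _ g : GL (Fin (2 + 2)) (AdeleRing (𝓞 L) L)) :
          Matrix (Fin (2 + 2)) (Fin (2 + 2)) (AdeleRing (𝓞 L) L)) *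
        ((SA⁻¹ : GL (Fin (2 + 2)) (AdeleRing (𝓞 L) L)) : Matrix (Fin (2 + 2)) (Fin (2 + 2)) (AdeleRing (𝓞 L) L)))
  (ha : a + a = 1)
  (hSA : Matrix.reindex (e₂ (n := 2)).symm (e₂ (n := 2)).symm (SA : Matrix (Fin (2 + 2)) (Fin (2 + 2)) (AdeleRing (𝓞 L) L)) =
    Matrix.fromBlocks (1 : Matrix (Fin 2) (Fin 2) (AdeleRing (𝓞 L) L)) (X.map ((algebraMap L (AdeleRing (𝓞 L) L)).comp (algebraMap (Fp L) L))) 1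
      (-(X.map ((algebraMap L (AdeleRing (𝓞 L) L)).comp (algebraMap (Fp L) L)))))
  (hSAi : Matrix.reindex (e₂ (n := 2)).symm (e₂ (n := 2)).symm ((SA⁻¹ : GL (Fin (2 + 2)) (AdeleRing (𝓞 L) L)) : Matrix (Fin (2 + 2)) (Fin (2 + 2)) (AdeleRing (𝓞 L) L)) =
    Matrix.fromBlocks ((a • (1 : Matrix (Fin 2) (Fin 2) (Fp L))).map ((algebraMap L (AdeleRing (𝓞 L) L)).comp (algebraMap (Fp L) L)))
      ((a • (1 : Matrix (Fin 2) (Fin 2) (Fp L))).map ((algebraMap L (AdeleRing (𝓞 L) L)).comp (algebraMap (Fp L) L)))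
      (Y.map ((algebraMap L (AdeleRing (𝓞 L) L)).comp (algebraMap (Fp L) L)))
      (-(Y.map ((algebraMap L (AdeleRing (𝓞 L) L)).comp (algebraMap (Fp L) L)))))
  (hΨP : ∀ b : (quasiSplit (Fp L) L (IsCMField.complexConj L) (2 + 2)).Adelic,
    ((adelicVal (Fp L) L (IsCMField.complexConj L) (2 + 2) _ b : GL (Fin (2 + 2)) (AdeleRing (𝓞 L) L)) :
        Matrix (Fin (2 + 2)) (Fin (2 + 2)) (AdeleRing (𝓞 L) L)).BlockTriangular id →
      IsSiegelDelta L e dV hdV dW hdW (Ψ b))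

/-! ## §1 Scalars -/

omit [IsCMField L] in
/-- `‖u⁻¹‖ = ‖u‖⁻¹` in `ℝ≥0`. [folklore] -/
theorem ideleNorm_inv_eq [IsCMField L] (u : (AdeleRing (𝓞 L) L)ˣ) :
    IdeleClassGroup.ideleNorm L u⁻¹ = (IdeleClassGroup.ideleNorm L u)⁻¹ := by
  have h : IdeleClassGroup.ideleNorm L u⁻¹ * IdeleClassGroup.ideleNorm L u = 1 := by rw [← map_mul, inv_mul_cancel, map_one]
  exact eq_inv_of_mul_eq_one_left h

omit [IsCMField L] in
/-- `‖u‖ ≠ 0`. [folklore] -/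
theorem ideleNorm_ne_zero [IsCMField L] (u : (AdeleRing (𝓞 L) L)ˣ) : IdeleClassGroup.ideleNorm L u ≠ 0 := by
  have h : IdeleClassGroup.ideleNorm L u * IdeleClassGroup.ideleNorm L u⁻¹ = 1 := by rw [← map_mul, mul_inv_cancel, map_one]
  exact left_ne_zero_of_mul_eq_one h

/-- **the exponent shift**: `(√x)^{2s+2} · x⁻¹ = (√x)^{2(s−½)+1}` for a real `x > 0`. [folklore] -/
theorem sqrt_cpow_shift {x : ℝ} (hx : 0 < x) (s : ℂ) :
    ((Real.sqrt x : ℝ) : ℂ) ^ (2 * s + ((2 : ℕ) : ℂ)) * ((x : ℝ) : ℂ)⁻¹ = ((Real.sqrt x : ℝ) : ℂ) ^ (2 * (s - 1 / 2) + 1) := by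
  have hx0 : ((x : ℝ) : ℂ) ≠ 0 := Complex.ofReal_ne_zero.2 hx.ne'
  rw [show (2 : ℂ) * s + ((2 : ℕ) : ℂ) = 2 * (s + 1) by push_cast; ring, show (2 : ℂ) * (s - 1 / 2) + 1 = 2 * s by ring,
    ofReal_sqrt_cpow_two_mul hx.le, ofReal_sqrt_cpow_two_mul hx.le, Complex.cpow_add _ _ hx0, Complex.cpow_one, mul_inv_cancel_right₀ hx0]

/-- **`D_T` for the Klingen substitution at `a = 1`**: `(t ↦ 1⁻¹·t·b₀₀)_*μ_T = ‖u⁻¹‖_𝔸 · μ_T` when `b₀₀ = u` (★ F5-o). [cite: WeilBNT1967, Ch. IV §3 Cor. 1] -/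
theorem map_scaleT_eq_ideleNorm_smul [MeasurableSpace (AdeleRing (𝓞 L) L)] [BorelSpace (AdeleRing (𝓞 L) L)] (μT : Measure (AdeleRing (𝓞 L) L)) [μT.IsAddHaarMeasure]
    (b : (quasiSplit (Fp L) L (IsCMField.complexConj L) 2).Adelic) (u : (AdeleRing (𝓞 L) L)ˣ) (hu : (u : AdeleRing (𝓞 L) L) = ((b.1 : GL (Fin 2) (AdeleRing (𝓞 L) L)) : Matrix (Fin 2) (Fin 2) (AdeleRing (𝓞 L) L)) 0 0) :
    μT.map (fun t : AdeleRing (𝓞 L) L => (((1 : (AdeleRing (𝓞 L) L)ˣ)⁻¹ : (AdeleRing (𝓞 L) L)ˣ) : AdeleRing (𝓞 L) L) * t * (((((jAdelic L 2).symm b : unitaryGroupOfForm (conjAdele (Fp L) L (IsCMField.complexConj L)) ((StdForm.antidiagonal 2).over (AdeleRing (𝓞 L) L))) : GL (Fin 2) (AdeleRing (𝓞 L) L)) : Matrix (Fin 2) (Fin 2) (AdeleRing (𝓞 L) L)) 0 0)) =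
      ((IdeleClassGroup.ideleNorm L u⁻¹ : ℝ≥0) : ℝ≥0∞) • μT := by
  have hfun : (fun t : AdeleRing (𝓞 L) L => (((1 : (AdeleRing (𝓞 L) L)ˣ)⁻¹ : (AdeleRing (𝓞 L) L)ˣ) : AdeleRing (𝓞 L) L) * t * (((((jAdelic L 2).symm b : unitaryGroupOfForm (conjAdele (Fp L) L (IsCMField.complexConj L)) ((StdForm.antidiagonal 2).over (AdeleRing (𝓞 L) L))) : GL (Fin 2) (AdeleRing (𝓞 L) L)) : Matrix (Fin 2) (Fin 2) (AdeleRing (𝓞 L) L)) 0 0)) = fun t => t * (u : AdeleRing (𝓞 L) L) := by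
    funext t; rw [coe_jAdelic_two_symm, ← hu, inv_one, Units.val_one, one_mul]
  rw [hfun, map_mul_right_eq_ideleNorm_smul μT u]

/-! ## §2 The law in E1's currency -/

include hΨ ha hSA hSAi hΨP in
/-- **(Q2) F8 — THE BOREL LAW OF THE INNER SECTION OF TERM 2 IN E1's CURRENCY** (E1 parameter `s − ½`): `F′_h(b g) = χ(u)·(√‖u‖)^{2(s−½)+1}·F′_h(g)` for EVERY
upper-triangular `b ∈ U(J₂)(𝔸_{L⁺})` (`b₁₀ = 0`, `u = b₀₀`), `F′_h(y) = ∫ f(Ψ(ξ)·Ψ(n_Q(q.1,0,q.2))·Ψ(jAdelic m_Q^𝔸(1,(jAdelic 2)⁻¹y))·h) d(μ_Y × μ_T)`, `μ_Y` left invariant, `μ_T` a Haar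
measure on `𝔸_L` — EXACTLY the `hF` of ★ E1 `summable_borelSection_two` at `s − ½`. [cite: MoeglinWaldspurger1995, II.1.7] [cite: Tan1999, §1] -/
theorem innerSection_borel_law [MeasurableSpace (AdeleRing (𝓞 L) L)] [BorelSpace (AdeleRing (𝓞 L) L)] [SecondCountableTopology (AdeleRing (𝓞 L) L)]
    (Y : AddSubgroup (AdeleRing (𝓞 L) L)) (hY : ∀ y, y ∈ Y ↔ conjAdele (Fp L) L (IsCMField.complexConj L) y = -y)
    (μY : Measure ↥Y) (μT : Measure (AdeleRing (𝓞 L) L)) [SFinite μY] [SFinite μT] [μY.IsAddLeftInvariant] [μT.IsAddHaarMeasure]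
    {χ : HeckeCharacter L} {s : ℂ} {f : HA L e dV hdV dW hdW → ℂ} (hf : IsSiegelDeltaSection L e dV hdV dW hdW χ s f) (hfc : Continuous f) (h : HA L e dV hdV dW hdW)
    (b g : (quasiSplit (Fp L) L (IsCMField.complexConj L) 2).Adelic) (u : (AdeleRing (𝓞 L) L)ˣ) (hb : ((b.1 : GL (Fin 2) (AdeleRing (𝓞 L) L)) : Matrix (Fin 2) (Fin 2) (AdeleRing (𝓞 L) L)) 1 0 = 0) (hu : (u : AdeleRing (𝓞 L) L) = ((b.1 : GL (Fin 2) (AdeleRing (𝓞 L) L)) : Matrix (Fin 2) (Fin 2) (AdeleRing (𝓞 L) L)) 0 0) :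
    (∫ q : ↥Y × AdeleRing (𝓞 L) L, f (Ψ (jAdelic L 4 (weylXi (AdeleRing (𝓞 L) L) (conjAdele (Fp L) L (IsCMField.complexConj L)))) * Ψ (jAdelic L 4 (nKlingen (AdeleRing (𝓞 L) L) (conjAdele (Fp L) L (IsCMField.complexConj L)) (conjAdele_conjAdele' L) (((q.1 : ↥Y) : AdeleRing (𝓞 L) L)) ((hY _).1 q.1.2) 0 (q.2))) * (Ψ (jAdelic L 4 (klingenLevi (AdeleRing (𝓞 L) L) (conjAdele (Fp L) L (IsCMField.complexConj L)) (conjAdele_conjAdele' L) 1 ((jAdelic L 2).symm (b * g)))) * h)) ∂(μY.prod μT)) =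
      ((χ u : ℂˣ) : ℂ) * ((Real.sqrt (Literature.NumberTheory.GaloisRepresentations.ideleNorm u) : ℝ) : ℂ) ^ (2 * (s - 1 / 2) + 1) * (∫ q : ↥Y × AdeleRing (𝓞 L) L, f (Ψ (jAdelic L 4 (weylXi (AdeleRing (𝓞 L) L) (conjAdele (Fp L) L (IsCMField.complexConj L)))) * Ψ (jAdelic L 4 (nKlingen (AdeleRing (𝓞 L) L) (conjAdele (Fp L) L (IsCMField.complexConj L)) (conjAdele_conjAdele' L) (((q.1 : ↥Y) : AdeleRing (𝓞 L) L)) ((hY _).1 q.1.2) 0 (q.2))) * (Ψ (jAdelic L 4 (klingenLevi (AdeleRing (𝓞 L) L) (conjAdele (Fp L) L (IsCMField.complexConj L)) (conjAdele_conjAdele' L) 1 ((jAdelic L 2).symm g))) * h)) ∂(μY.prod μT)) := by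
  have hbA : (((((jAdelic L 2).symm b : unitaryGroupOfForm (conjAdele (Fp L) L (IsCMField.complexConj L)) ((StdForm.antidiagonal 2).over (AdeleRing (𝓞 L) L))) : GL (Fin 2) (AdeleRing (𝓞 L) L)) : Matrix (Fin 2) (Fin 2) (AdeleRing (𝓞 L) L)) 1 0) = 0 := by rw [coe_jAdelic_two_symm]; exact hb
  -- letters: `m_Q(1, j⁻¹(b g)) = m_Q(1, j⁻¹ b) · m_Q(1, j⁻¹ g)`
  rw [map_mul (jAdelic L 2).symm, klingenLevi_one_mul, map_mul, map_mul, mul_assoc]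
  -- the law ★ F5-c with ★ F5-n's substitution and the two moduli
  have hlaw := klingenInner_levi_law hΨ ha hSA hSAi hΨP (μY.prod μT) (fun q : ↥Y × AdeleRing (𝓞 L) L => ((q.1 : ↥Y) : AdeleRing (𝓞 L) L)) (fun q => (hY _).1 q.1.2)
    (fun q : ↥Y × AdeleRing (𝓞 L) L => q.2) 1 hbA _ (fst_klingenSubst Y hY 1 hbA) (snd_klingenSubst Y hY 1 hbA) hf
    (fun x' => (∫ q : ↥Y × AdeleRing (𝓞 L) L, f (Ψ (jAdelic L 4 (weylXi (AdeleRing (𝓞 L) L) (conjAdele (Fp L) L (IsCMField.complexConj L)))) * Ψ (jAdelic L 4 (nKlingen (AdeleRing (𝓞 L) L) (conjAdele (Fp L) L (IsCMField.complexConj L)) (conjAdele_conjAdele' L) (((q.1 : ↥Y) : AdeleRing (𝓞 L) L)) ((hY _).1 q.1.2) 0 (q.2))) * (x')) ∂(μY.prod μT))) (fun x' => rfl) _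
    (klingenInner_hscale hΨ Y hY μY μT 1 hbA (map_scaleY_one_eq Y hY μY) (map_scaleT_eq_ideleNorm_smul μT b u hu) hfc)
    (Ψ (jAdelic L 4 (klingenLevi (AdeleRing (𝓞 L) L) (conjAdele (Fp L) L (IsCMField.complexConj L)) (conjAdele_conjAdele' L) 1 ((jAdelic L 2).symm g))) * h)
  rw [hlaw]
  congr 1
  -- the scalar: `siegelDeltaCharacter(Ψ(ξ m ξ⁻¹)) · ‖u⁻¹‖ = χ(u)(√‖u‖)^{2s+2}‖u‖⁻¹ = χ(u)(√‖u‖)^{2(s−½)+1}`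
  have hdet : detDelta L e dV hdV dW hdW (Ψ (jAdelic L 4 ((weylXi (AdeleRing (𝓞 L) L) (conjAdele (Fp L) L (IsCMField.complexConj L))) * klingenLevi (AdeleRing (𝓞 L) L) (conjAdele (Fp L) L (IsCMField.complexConj L)) (conjAdele_conjAdele' L) 1 ((jAdelic L 2).symm b) * (weylXi (AdeleRing (𝓞 L) L) (conjAdele (Fp L) L (IsCMField.complexConj L)))⁻¹))) =
      (u : AdeleRing (𝓞 L) L) := by
    rw [detDelta_transport_weylXi_conj_klingenLevi hΨ ha hSA hSAi 1 hbA, coe_jAdelic_two_symm, ← hu, inv_one, Units.val_one, map_one, mul_one]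
  have hunit : IsUnit (detDelta L e dV hdV dW hdW (Ψ (jAdelic L 4 ((weylXi (AdeleRing (𝓞 L) L) (conjAdele (Fp L) L (IsCMField.complexConj L))) * klingenLevi (AdeleRing (𝓞 L) L) (conjAdele (Fp L) L (IsCMField.complexConj L)) (conjAdele_conjAdele' L) 1 ((jAdelic L 2).symm b) * (weylXi (AdeleRing (𝓞 L) L) (conjAdele (Fp L) L (IsCMField.complexConj L)))⁻¹)))) := by
    rw [hdet]; exact u.isUnit
  have hunit_eq : hunit.unit = u := Units.ext (by rw [IsUnit.unit_spec, hdet])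
  have hx : 0 < Literature.NumberTheory.GaloisRepresentations.ideleNorm u := by
    rw [← coe_ideleNorm]; exact_mod_cast pos_iff_ne_zero.2 (ideleNorm_ne_zero u)
  unfold siegelDeltaCharacter chiDet modDelta
  rw [dif_pos hunit, dif_pos hunit, hunit_eq, one_mul, ENNReal.coe_toReal, ideleNorm_inv_eq, NNReal.coe_inv, Complex.ofReal_inv, coe_ideleNorm, mul_assoc,
    sqrt_cpow_shift hx]

include hΨ ha hSA hSAi hΨP in
/-- **GODEMENT CONVERGENCE OF THE E1 SERIES OF TERM 2 on `re s > 1`, GIVEN the continuity of `F′_h` in `y`** (a parametric integral: dominated convergence, BY VALUE here) —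
★ E1 `summable_borelSection_two` at the parameter `s − ½` (`½ < re(s − ½)`). [cite: MoeglinWaldspurger1995, II.1.5] [cite: Garrett2018, §3.10] -/
theorem summable_innerSection_of_continuous [MeasurableSpace (AdeleRing (𝓞 L) L)] [BorelSpace (AdeleRing (𝓞 L) L)] [SecondCountableTopology (AdeleRing (𝓞 L) L)]
    (Y : AddSubgroup (AdeleRing (𝓞 L) L)) (hY : ∀ y, y ∈ Y ↔ conjAdele (Fp L) L (IsCMField.complexConj L) y = -y)
    (μY : Measure ↥Y) (μT : Measure (AdeleRing (𝓞 L) L)) [SFinite μY] [SFinite μT] [μY.IsAddLeftInvariant] [μT.IsAddHaarMeasure]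
    (χ : HeckeCharacter L) (hχ : χ.IsUnitary) {s : ℂ} (hs : 1 < s.re)
    {f : HA L e dV hdV dW hdW → ℂ} (hf : IsSiegelDeltaSection L e dV hdV dW hdW χ s f) (hfc : Continuous f) (h : HA L e dV hdV dW hdW)
    (hFc : Continuous fun y : (quasiSplit (Fp L) L (IsCMField.complexConj L) 2).Adelic => (∫ q : ↥Y × AdeleRing (𝓞 L) L, f (Ψ (jAdelic L 4 (weylXi (AdeleRing (𝓞 L) L) (conjAdele (Fp L) L (IsCMField.complexConj L)))) * Ψ (jAdelic L 4 (nKlingen (AdeleRing (𝓞 L) L) (conjAdele (Fp L) L (IsCMField.complexConj L)) (conjAdele_conjAdele' L) (((q.1 : ↥Y) : AdeleRing (𝓞 L) L)) ((hY _).1 q.1.2) 0 (q.2))) * (Ψ (jAdelic L 4 (klingenLevi (AdeleRing (𝓞 L) L) (conjAdele (Fp L) L (IsCMField.complexConj L)) (conjAdele_conjAdele' L) 1 ((jAdelic L 2).symm y))) * h)) ∂(μY.prod μT))) (g : (quasiSplit (Fp L) L (IsCMField.complexConj L) 2).Adelic) :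
    Summable fun w : Quotient (orbitRel
        ↥(borelU ((IsCMField.complexConj L : L ≃ₐ[Fp L] L) : L →+* L) ((StdForm.antidiagonal 2).over L))
        ↥(unitaryGroupOfForm ((IsCMField.complexConj L : L ≃ₐ[Fp L] L) : L →+* L) ((StdForm.antidiagonal 2).over L))) =>
      ‖(∫ q : ↥Y × AdeleRing (𝓞 L) L, f (Ψ (jAdelic L 4 (weylXi (AdeleRing (𝓞 L) L) (conjAdele (Fp L) L (IsCMField.complexConj L)))) * Ψ (jAdelic L 4 (nKlingen (AdeleRing (𝓞 L) L) (conjAdele (Fp L) L (IsCMField.complexConj L)) (conjAdele_conjAdele' L) (((q.1 : ↥Y) : AdeleRing (𝓞 L) L)) ((hY _).1 q.1.2) 0 (q.2))) * (Ψ (jAdelic L 4 (klingenLevi (AdeleRing (𝓞 L) L) (conjAdele (Fp L) L (IsCMField.complexConj L)) (conjAdele_conjAdele' L) 1 ((jAdelic L 2).symm ((quasiSplit (Fp L) L (IsCMField.complexConj L) 2).toAdelic (Quotient.out w) * g)))) * h)) ∂(μY.prod μT))‖ := by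
  have hs' : (1 : ℝ) / 2 < (s - 1 / 2).re := by
    simp only [Complex.sub_re, Complex.div_ofNat_re, Complex.one_re]; linarith
  exact summable_borelSection_two L χ hχ (s - 1 / 2) hs' (F := fun y : (quasiSplit (Fp L) L (IsCMField.complexConj L) 2).Adelic => (∫ q : ↥Y × AdeleRing (𝓞 L) L, f (Ψ (jAdelic L 4 (weylXi (AdeleRing (𝓞 L) L) (conjAdele (Fp L) L (IsCMField.complexConj L)))) * Ψ (jAdelic L 4 (nKlingen (AdeleRing (𝓞 L) L) (conjAdele (Fp L) L (IsCMField.complexConj L)) (conjAdele_conjAdele' L) (((q.1 : ↥Y) : AdeleRing (𝓞 L) L)) ((hY _).1 q.1.2) 0 (q.2))) * (Ψ (jAdelic L 4 (klingenLevi (AdeleRing (𝓞 L) L) (conjAdele (Fp L) L (IsCMField.complexConj L)) (conjAdele_conjAdele' L) 1 ((jAdelic L 2).symm y))) * h)) ∂(μY.prod μT))) hFc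
    (fun b g' u hb hu => innerSection_borel_law hΨ ha hSA hSAi hΨP Y hY μY μT hf hfc h b g' u hb hu) g

end Transport

end Summit.HodgeConjecture.HodgeConjecture.Cruxes.HLiu418.K2LiuKlingenInnerSectionE1Law

end
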